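import Summits.QuantumFields.YangMills.Theorems.LuscherReductionTwistedTraceScalingBTDiagonalPhase
import HarnessLib

/-!
# The DIAGONAL colour average, pointwise in the fluctuation: `1 − ε₂ ≤ ∫_d exp(diagX β (dud⁻¹) v v' g) dd ≤ 1 + ε₂ + (ε₁ + ε₂)²`
# (lane A of S-BASE, crux `TwistedTraceScaling` stmt-QuantumFields-20203, C4-CORE, the (B-T) pen (L3); design note `pub/ym-fleet/ym-luscher-20007-p1/COARSE-DESIGN.md` §25.7)

The heart of (L3) at the pointwise level.  For a slow datum `u` (colour vectors of Euclidean size `≤ τu`, one-site action `L³S₁(u) ≤ σ`) and a fixed fluctuation `z = (v, v', g)` on the cap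
(`|v_{e,c}|, |v'_{e,c}| ≤ τ ≤ 1/30`): the colour average over the conjugates `dud⁻¹` of the exponential of the diagonal Laplace exponent `diagX` (`…BTDiagonalPhase`) is `1` up to the explicit
second-order quantities
`ε₁ = β·[24τu·Σ_e‖g⃗_y‖‖M⃗_e‖ + 80τu·N·(‖v̂‖²+‖v̂'‖²)]`, `ε₂ = β·[48τu²Σ_e‖g⃗_y‖‖M⃗_e‖] + (β/2)Σ_{w=v̂,v̂'}[50σN‖w‖² + E(τ,σ) + E(τ,0) + 1.45·10⁸Nτu²‖w‖²]`
— by `integral_exp_sandwich_of_integral_eq_zero` (`…BTColourAveraging`) with `X₁(d) = diagX1(slowLin(dud⁻¹))` (zero mean: `integral_diagX1_conj_eq_zero`), `X₂ = diagX − X₁`.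
* `measurable_diagX_conj`, `measurable_diagX1_conj` (continuity in the colour rotation `d`);
* `abs_adRot_slowLin_apply_le` (`|(Ad(d)c_k)_a| ≤ 2τu`), `abs_vecPart_conj_apply_le` (`|((dud⁻¹)_k)⃗_a| ≤ τu`) from `Σ_a u⃗_{k,a}² ≤ τu²` (rotation invariant);
* ★★★ `haar_integral_exp_diagX_sandwich`.
On the core `‖v‖,‖v'‖,‖g⃗‖ = O(β^{-1/2}log β)`, `τu = O(β^{-s})`, `σ = O(L³β^{-4s})`: `ε₁ = O(β^{-s}log²β)`, `ε₂ = O(β^{-2s}log²β + β^{-1/2}log³β)` (§25.7).  Successor: Fubini (`fpBOKernel` as one product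
integral, `∫_d` innermost via `fpBOKernel_conj`) ⇒ `|f(u) − f(1)| ≤ (ε₂ + (ε₁+ε₂)²)·f(1)` on the g-core; tails (L1); floor.
HONEST FRAMING: bookkeeping for a stub of a child of the CONDITIONAL reduction route R2b1; the Laplace core of (B-T) is OPEN; C4-CORE OPEN; not infinite volume, not a gap, not Clay.
-/

set_option autoImplicit false

noncomputable section

open MeasureTheory Filter Topology Real
open scoped BigOperators Matrix InnerProductSpace RealInnerProductSpace
open Literature.MathematicalPhysics.QuantumFieldTheory
open Literature.MathematicalPhysics.QuantumLattice

namespace Summit.QuantumFields.YangMills.Theorems.FemtoTransferGap.TwoLattice.ConstTube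

open Summit.QuantumFields.YangMills.Theorems.FemtoTransferGap
open Summit.QuantumFields.YangMills.Theorems.FemtoTransferGap.TwoLattice
open Summit.QuantumFields.YangMills.Theorems.FemtoTransferGap.TwoLattice.Avg
open Summit.QuantumFields.YangMills.Theorems.FemtoTransferGap.TwoLattice.Stiff
open Summit.QuantumFields.YangMills.Theorems.FemtoTransferGap.TwoLattice.Cov
open Summit.QuantumFields.YangMills.Theorems.FemtoTransferGap.TwoLattice.Toron

variable {L : ℕ} [NeZero L]

/-! ## §1 Measurability in the colour rotation -/

/-- `d ↦ diagX β (dud⁻¹) v v' g` is measurable (indeed continuous). [folklore] -/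
theorem measurable_diagX_conj (β : ℝ) (u : GaugeConfig 3 1 SU2) (v v' : Edge 3 L → Fin 3 → ℝ) (g : Site 3 L → SU2) :
    Measurable fun d : SU2 => diagX L β (gaugeTransform (fun _ : Site 3 1 => d) u) v v' g := by
  haveI : SecondCountableTopology SU2 := secondCountableTopology_su2
  have hc : Measurable fun d : SU2 => gaugeTransform (fun _ : Site 3 1 => d) u := measurable_constGaugeAction_left (L := 1) u
  have hTC : Measurable fun p : GaugeConfig 3 L SU2 × GaugeConfig 3 L SU2 => timeCoupling su2Rep p.1 p.2 := (continuous_timeCoupling su2Rep continuous_su2Rep).measurable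
  have hS : Measurable fun U : GaugeConfig 3 L SU2 => wilsonAction su2Rep U := (continuous_wilsonAction su2Rep continuous_su2Rep).measurable
  have hS1 : Measurable fun U : GaugeConfig 3 1 SU2 => wilsonAction su2Rep U := (continuous_wilsonAction su2Rep continuous_su2Rep).measurable
  have hoT : ∀ w : Edge 3 L → Fin 3 → ℝ, Measurable fun d : SU2 => orthoTube L (gaugeTransform (fun _ : Site 3 1 => d) u) w := fun w =>
    (measurable_orthoTube_left (L := L) w).comp hc
  have hg : ∀ w : Edge 3 L → Fin 3 → ℝ, Measurable fun d : SU2 => gaugeTransform g (orthoTube L (gaugeTransform (fun _ : Site 3 1 => d) u) w) := fun w => by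
    have hp : Measurable fun d : SU2 => (orthoTube L (gaugeTransform (fun _ : Site 3 1 => d) u) w, g) := (hoT w).prodMk measurable_const
    have h := (measurable_gaugeAction (L := L)).comp hp
    simpa only [Function.comp_def] using h
  have h1 : Measurable fun d : SU2 => timeCoupling su2Rep (orthoTube L (gaugeTransform (fun _ : Site 3 1 => d) u) v)
      (gaugeTransform g (orthoTube L (gaugeTransform (fun _ : Site 3 1 => d) u) v')) := by
    have h := hTC.comp ((hoT v).prodMk (hg v'))
    simpa only [Function.comp_def] using h
  have h2 : ∀ w, Measurable fun d : SU2 => wilsonAction su2Rep (orthoTube L (gaugeTransform (fun _ : Site 3 1 => d) u) w) := fun w => hS.comp (hoT w)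
  have h3 : Measurable fun d : SU2 => wilsonAction su2Rep (gaugeTransform (fun _ : Site 3 1 => d) u) := hS1.comp hc
  unfold diagX
  exact (((measurable_const.mul (h1.sub measurable_const)).sub (measurable_const.mul (((h2 v).sub (measurable_const.mul h3)).sub measurable_const))).sub
    (measurable_const.mul (((h2 v').sub (measurable_const.mul h3)).sub measurable_const)))

/-- `d ↦ diagX1 β (slowLin (dud⁻¹)) v v' g` is measurable. [folklore] -/
theorem measurable_diagX1_conj (β : ℝ) (u : GaugeConfig 3 1 SU2) (v v' : Edge 3 L → Fin 3 → ℝ) (g : Site 3 L → SU2) :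
    Measurable fun d : SU2 => diagX1 L β (slowLin (gaugeTransform (fun _ : Site 3 1 => d) u)) v v' g := by
  haveI : SecondCountableTopology SU2 := secondCountableTopology_su2
  simp_rw [diagX1_slowLin_conj]
  have hck : ∀ k : Fin 3, Continuous fun d : SU2 => (adRot d).mulVec (slowLin u k) := fun k => continuous_adRot_mulVec _
  have hkin : Continuous fun d : SU2 => ∑ e : Edge 3 L, (adRot d).mulVec (slowLin u e.2) ⬝ᵥ (vecPart (g (e.1.shift e.2)) ⨯₃ vecPart (linkM L v v' g e)) :=
    continuous_finsetSum _ fun e _ => (hck e.2).dotProduct continuous_const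
  have hcc : Continuous fun d : SU2 => (fun k => (adRot d).mulVec (slowLin u k) : Fin 3 → Fin 3 → ℝ) := continuous_pi hck
  have hmag : ∀ w : LinkSpace L, Continuous fun d : SU2 => ⟪covCurl (1 : GaugeConfig 3 L SU2) w, covCurlLin (fun k => (adRot d).mulVec (slowLin u k)) w⟫ := fun w => by
    have hlin : Continuous fun c : Fin 3 → Fin 3 → ℝ => stiffLinForm L w c := (stiffLinForm L w).continuous_of_finiteDimensional
    have h := hlin.comp hcc
    simpa only [Function.comp_def, stiffLinForm_apply] using h
  have hkinm : Measurable fun d : SU2 => ∑ e : Edge 3 L, (adRot d).mulVec (slowLin u e.2) ⬝ᵥ (vecPart (g (e.1.shift e.2)) ⨯₃ vecPart (linkM L v v' g e)) := hkin.measurable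
  have hmagm : ∀ w : LinkSpace L, Measurable fun d : SU2 => ⟪covCurl (1 : GaugeConfig 3 L SU2) w, covCurlLin (fun k => (adRot d).mulVec (slowLin u k)) w⟫ :=
    fun w => (hmag w).measurable
  unfold diagX1
  show Measurable fun d : SU2 => β * -(2 * ∑ e : Edge 3 L, (adRot d).mulVec (slowLin u e.2) ⬝ᵥ (vecPart (g (e.1.shift e.2)) ⨯₃ vecPart (linkM L v v' g e))) -
      β / 2 * (2 * ⟪covCurl (1 : GaugeConfig 3 L SU2) (linkEmbed L v), covCurlLin (fun k => (adRot d).mulVec (slowLin u k)) (linkEmbed L v)⟫) -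
      β / 2 * (2 * ⟪covCurl (1 : GaugeConfig 3 L SU2) (linkEmbed L v'), covCurlLin (fun k => (adRot d).mulVec (slowLin u k)) (linkEmbed L v')⟫)
  exact ((measurable_const.mul (measurable_const.mul hkinm).neg).sub (measurable_const.mul (measurable_const.mul (hmagm _)))).sub
    (measurable_const.mul (measurable_const.mul (hmagm _)))

/-! ## §2 Rotation-invariant size of the slow datum -/

/-- If `Σ_a u⃗_{k,a}² ≤ τu²` then every conjugate has `|((dud⁻¹)_k)⃗_a| ≤ τu`. [folklore] -/
theorem abs_vecPart_conj_apply_le {u : GaugeConfig 3 1 SU2} {τu : ℝ} (hτu : 0 ≤ τu) (hu : ∀ k : Fin 3, ∑ a, vecPart (u (0, k)) a ^ 2 ≤ τu ^ 2) (d : SU2) (k a : Fin 3) :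
    |vecPart (gaugeTransform (fun _ : Site 3 1 => d) u (0, k)) a| ≤ τu := by
  rw [gaugeTransform_const_apply', vecPart_conj]
  have h1 : |(adRot d).mulVec (vecPart (u (0, k))) a| ^ 2 ≤ ∑ b, ((adRot d).mulVec (vecPart (u (0, k))) b) ^ 2 := by
    rw [sq_abs]; exact Finset.single_le_sum (f := fun b => ((adRot d).mulVec (vecPart (u (0, k))) b) ^ 2) (fun b _ => sq_nonneg _) (Finset.mem_univ a)
  rw [sum_sq_adRot_mulVec] at h1
  exact (pow_le_pow_iff_left₀ (abs_nonneg _) hτu two_ne_zero).mp (h1.trans (hu k))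

/-- … and the rotated colour vectors satisfy `|(Ad(d)·slowLin u k)_a| ≤ 2τu`. [folklore] -/
theorem abs_adRot_slowLin_apply_le {u : GaugeConfig 3 1 SU2} {τu : ℝ} (hτu : 0 ≤ τu) (hu : ∀ k : Fin 3, ∑ a, vecPart (u (0, k)) a ^ 2 ≤ τu ^ 2) (d : SU2) (k a : Fin 3) :
    |((adRot d).mulVec (slowLin u k)) a| ≤ 2 * τu := by
  rw [← slowLin_conj]
  exact abs_slowLin_le _ (abs_vecPart_conj_apply_le hτu hu d) k a

/-- The sup norm of the conjugated vector part: `‖((dud⁻¹)_k)⃗‖ ≤ τu`. [folklore] -/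
theorem norm_vecPart_conj_le {u : GaugeConfig 3 1 SU2} {τu : ℝ} (hτu : 0 ≤ τu) (hu : ∀ k : Fin 3, ∑ a, vecPart (u (0, k)) a ^ 2 ≤ τu ^ 2) (d : SU2) (k : Fin 3) :
    ‖vecPart (gaugeTransform (fun _ : Site 3 1 => d) u (0, k))‖ ≤ τu :=
  (pi_norm_le_iff_of_nonneg hτu).mpr fun a => by rw [Real.norm_eq_abs]; exact abs_vecPart_conj_apply_le hτu hu d k a

/-! ## §3 ★★★ The diagonal Haar sandwich -/

/-- ★★★ **THE DIAGONAL COLOUR AVERAGE IS `1` TO SECOND ORDER, POINTWISE IN THE FLUCTUATION.** [cite: Luscher1983, §3] -/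
theorem haar_integral_exp_diagX_sandwich {β : ℝ} (hβ : 0 ≤ β) (u : GaugeConfig 3 1 SU2) {v v' : Edge 3 L → Fin 3 → ℝ} (hv : v ∈ capBalancedSet L)
    (hv' : v' ∈ capBalancedSet L) {τ σ τu : ℝ} (hτ : τ ≤ 1 / 30) (hσ : σ < 2) (hσ0 : 0 ≤ σ) (hS : (L : ℝ) ^ 3 * wilsonAction su2Rep u ≤ σ)
    (hvτ : ∀ (e : Edge 3 L) (c : Fin 3), |v e c| ≤ τ) (hvτ' : ∀ (e : Edge 3 L) (c : Fin 3), |v' e c| ≤ τ) (hτu0 : 0 ≤ τu) (hτu : τu ≤ 1)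
    (hu : ∀ k : Fin 3, ∑ a, vecPart (u (0, k)) a ^ 2 ≤ τu ^ 2) (g : Site 3 L → SU2) {ε₁ ε₂ : ℝ}
    (hε₁ : β * (12 * ∑ e : Edge 3 L, (2 * τu) * ‖vecPart (g (e.1.shift e.2))‖ * ‖vecPart (linkM L v v' g e)‖) +
      β * (40 * (2 * τu) * (Fintype.card (Plaquette 3 L × Fin 3) : ℝ) * (‖linkEmbed L v‖ ^ 2 + ‖linkEmbed L v'‖ ^ 2)) ≤ ε₁)
    (hε₂ : β * (48 * ∑ e : Edge 3 L, τu ^ 2 * ‖vecPart (g (e.1.shift e.2))‖ * ‖vecPart (linkM L v v' g e)‖) +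
      β / 2 * ((σ / 2 * (10 * Real.sqrt (Fintype.card (Plaquette 3 L × Fin 3)) * ‖linkEmbed L v‖) ^ 2 + stepActionErr (L := L) τ σ) + stepActionErr (L := L) τ 0 +
        145000000 * (Fintype.card (Plaquette 3 L × Fin 3) : ℝ) * τu ^ 2 * ‖linkEmbed L v‖ ^ 2) +
      β / 2 * ((σ / 2 * (10 * Real.sqrt (Fintype.card (Plaquette 3 L × Fin 3)) * ‖linkEmbed L v'‖) ^ 2 + stepActionErr (L := L) τ σ) + stepActionErr (L := L) τ 0 +
        145000000 * (Fintype.card (Plaquette 3 L × Fin 3) : ℝ) * τu ^ 2 * ‖linkEmbed L v'‖ ^ 2) ≤ ε₂)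
    (hε : ε₁ + ε₂ ≤ 1) :
    1 - ε₂ ≤ ∫ d, Real.exp (diagX L β (gaugeTransform (fun _ : Site 3 1 => d) u) v v' g) ∂haarProbability SU2 ∧
      ∫ d, Real.exp (diagX L β (gaugeTransform (fun _ : Site 3 1 => d) u) v v' g) ∂haarProbability SU2 ≤ 1 + ε₂ + (ε₁ + ε₂) ^ 2 := by
  set X₁ : SU2 → ℝ := fun d => diagX1 L β (slowLin (gaugeTransform (fun _ : Site 3 1 => d) u)) v v' g with hX₁
  set X₂ : SU2 → ℝ := fun d => diagX L β (gaugeTransform (fun _ : Site 3 1 => d) u) v v' g - X₁ d with hX₂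
  have hX₁m : Measurable X₁ := measurable_diagX1_conj β u v v' g
  have hX₂m : Measurable X₂ := (measurable_diagX_conj β u v v' g).sub hX₁m
  have hsum : ∀ d, diagX L β (gaugeTransform (fun _ : Site 3 1 => d) u) v v' g = X₁ d + X₂ d := fun d => by rw [hX₂]; ring
  simp_rw [hsum]
  -- zero mean of the linear part
  have hmean : ∫ d, X₁ d ∂haarProbability SU2 = 0 := integral_diagX1_conj_eq_zero β u v v' g
  -- bound on the linear part, uniform over the conjugates
  have h1 : ∀ d, |X₁ d| ≤ ε₁ := fun d => by
    rw [hX₁]; dsimp only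
    rw [diagX1_slowLin_conj]
    have h := abs_diagX1_le (L := L) hβ (c := fun k => (adRot d).mulVec (slowLin u k)) (α := 2 * τu) (fun k a => abs_adRot_slowLin_apply_le hτu0 hu d k a) v v' g
    refine h.trans (le_trans ?_ hε₁)
    have hck : ∀ e : Edge 3 L, ‖(adRot d).mulVec (slowLin u e.2)‖ ≤ 2 * τu := fun e =>
      (pi_norm_le_iff_of_nonneg (by positivity)).mpr fun a => by rw [Real.norm_eq_abs]; exact abs_adRot_slowLin_apply_le hτu0 hu d e.2 a
    have hs : ∑ e : Edge 3 L, ‖(adRot d).mulVec (slowLin u e.2)‖ * ‖vecPart (g (e.1.shift e.2))‖ * ‖vecPart (linkM L v v' g e)‖ ≤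
        ∑ e : Edge 3 L, (2 * τu) * ‖vecPart (g (e.1.shift e.2))‖ * ‖vecPart (linkM L v v' g e)‖ :=
      Finset.sum_le_sum fun e _ => mul_le_mul_of_nonneg_right (mul_le_mul_of_nonneg_right (hck e) (norm_nonneg _)) (norm_nonneg _)
    nlinarith [hs]
  -- bound on the second-order part, uniform over the conjugates
  have h2 : ∀ d, |X₂ d| ≤ ε₂ := fun d => by
    rw [hX₂, hX₁]; dsimp only
    have hSd : (L : ℝ) ^ 3 * wilsonAction su2Rep (gaugeTransform (fun _ : Site 3 1 => d) u) ≤ σ := by rw [wilsonAction_gaugeTransform]; exact hS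
    have hud : ∀ (k : Fin 3) (a : Fin 3), |vecPart (gaugeTransform (fun _ : Site 3 1 => d) u (0, k)) a| ≤ τu := abs_vecPart_conj_apply_le hτu0 hu d
    have h := abs_diagX_sub_diagX1_le (L := L) hβ (gaugeTransform (fun _ : Site 3 1 => d) u) hv hv' hτ hσ hSd hvτ hvτ' hτu hud g
    refine h.trans (le_trans ?_ hε₂)
    set N : ℝ := (Fintype.card (Plaquette 3 L × Fin 3) : ℝ)
    have hn : ∀ e : Edge 3 L, ‖vecPart (gaugeTransform (fun _ : Site 3 1 => d) u (0, e.2))‖ ^ 2 ≤ τu ^ 2 := fun e =>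
      pow_le_pow_left₀ (norm_nonneg _) (norm_vecPart_conj_le hτu0 hu d e.2) 2
    have hs : ∑ e : Edge 3 L, ‖vecPart (gaugeTransform (fun _ : Site 3 1 => d) u (0, e.2))‖ ^ 2 * ‖vecPart (g (e.1.shift e.2))‖ * ‖vecPart (linkM L v v' g e)‖ ≤
        ∑ e : Edge 3 L, τu ^ 2 * ‖vecPart (g (e.1.shift e.2))‖ * ‖vecPart (linkM L v v' g e)‖ :=
      Finset.sum_le_sum fun e _ => mul_le_mul_of_nonneg_right (mul_le_mul_of_nonneg_right (hn e) (norm_nonneg _)) (norm_nonneg _)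
    have hD : ∀ w : LinkSpace L, ‖covCurl (constLift L (gaugeTransform (fun _ : Site 3 1 => d) u)) w‖ ^ 2 ≤ (10 * Real.sqrt N * ‖w‖) ^ 2 := fun w =>
      pow_le_pow_left₀ (norm_nonneg _) (norm_covCurl_le_op _ w) 2
    have hDv := hD (linkEmbed L v)
    have hDv' := hD (linkEmbed L v')
    have hβ2 : 0 ≤ β / 2 := by linarith
    have hσ4 : 0 ≤ σ / 2 := by linarith
    nlinarith [mul_le_mul_of_nonneg_left hs (by positivity : (0 : ℝ) ≤ β * 48), mul_le_mul_of_nonneg_left (mul_le_mul_of_nonneg_left hDv hσ4) hβ2,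
      mul_le_mul_of_nonneg_left (mul_le_mul_of_nonneg_left hDv' hσ4) hβ2]
  exact integral_exp_sandwich_of_integral_eq_zero (haarProbability SU2) hX₁m hX₂m h1 h2 hε hmean

end Summit.QuantumFields.YangMills.Theorems.FemtoTransferGap.TwoLattice.ConstTube

end
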